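import Summits.Ventures.PercRepro.RankLevelSetPrimeCover

/-!
# PercRepro — a non-user's cover cuts a side into two proper closed pieces (p9, gen 27)

In the vocabulary of RankLevelSetPrimeCover: `H` is a `G`-closed set and `y ∈ G ∖ H` has a cover `(P, Q)` by `G`-closed
sets avoiding `y` (`G ∖ {y} ⊆ P ∪ Q`).  If `y` is NOT a user of `H` — neither side contains `H` — then `P ∩ H` and `Q ∩ H`
are `H`-closed (flats of the restriction to `H`), proper, cover `H`, and each has rank strictly below `r(H)`.
This is the soundness of the PLANE-COVER FILTER of the `f(5)` census (proofs/P9-FLATBOUND-g25.md §8): a cover side `A₀` of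
rank 4 that some other point does not use is the union of two rank-`≤ 3` flats of `A₀`.

* **`gclosed_inter_of_gclosed`** — `P ∩ H` is `H`-closed when `P` is `G`-closed and `H ⊆ G`;
* **`side_cover_of_not_user`** — the two pieces cover `H`, are `H`-closed and have rank `< r(H)`.
Axioms: standard.  Nothing here moves a window; NO window claim (p9 owns S4).
-/

open scoped Matroid

namespace PercRepro

namespace ThmN

open Set

variable {α : Type}

/-- The trace `P ∩ H` of a `G`-closed set `P` on `H ⊆ G` is `H`-closed. -/
theorem gclosed_inter_of_gclosed {M : Matroid α} {G H P : Set α} (hHG : H ⊆ G) (hP : GClosed M G P) :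
    GClosed M H (P ∩ H) :=
  ⟨Set.inter_subset_right, fun _ hz =>
    ⟨hP.2 ⟨M.closure_subset_closure Set.inter_subset_left hz.1, hHG hz.2⟩, hz.2⟩⟩

/-- **A non-user's cover cuts the side**: if `y ∈ G ∖ H` has the cover `(P, Q)` and neither `P` nor `Q` contains `H`,
then `H ⊆ (P ∩ H) ∪ (Q ∩ H)`, both pieces are `H`-closed, and both have rank `< r(H)`. -/
theorem side_cover_of_not_user (M : Matroid α) [M.Finite] {G H P Q : Set α} {y : α} (hG : G ⊆ M.E)
    (hH : GClosed M G H) (hP : GClosed M G P) (hQ : GClosed M G Q) (hyH : y ∉ H)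
    (hcov : G \ {y} ⊆ P ∪ Q) (hHP : ¬ H ⊆ P) (hHQ : ¬ H ⊆ Q) :
    H ⊆ (P ∩ H) ∪ (Q ∩ H) ∧ GClosed M H (P ∩ H) ∧ GClosed M H (Q ∩ H) ∧
      M.eRk (P ∩ H) < M.eRk H ∧ M.eRk (Q ∩ H) < M.eRk H := by
  have hHE : H ⊆ M.E := hH.1.trans hG
  have hcovH : H ⊆ (P ∩ H) ∪ (Q ∩ H) := by
    intro z hz
    have hzy : z ≠ y := fun h => hyH (h ▸ hz)
    rcases hcov ⟨hH.1 hz, hzy⟩ with h | h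
    · exact Or.inl ⟨h, hz⟩
    · exact Or.inr ⟨h, hz⟩
  have hPH : GClosed M H (P ∩ H) := gclosed_inter_of_gclosed hH.1 hP
  have hQH : GClosed M H (Q ∩ H) := gclosed_inter_of_gclosed hH.1 hQ
  obtain ⟨z, hzH, hzP⟩ := Set.not_subset.1 hHP
  obtain ⟨w, hwH, hwQ⟩ := Set.not_subset.1 hHQ
  refine ⟨hcovH, hPH, hQH, ?_, ?_⟩
  · exact eRk_lt_of_gclosed_ssubset M hHE hPH hzH (fun h => hzP h.1)
  · exact eRk_lt_of_gclosed_ssubset M hHE hQH hwH (fun h => hwQ h.1)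

end ThmN

end PercRepro
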